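import Summits.FinalStateConjecture.FinalStateConjecture.Theorems.NearExtremalKappaCapture.Negative.ExponentMonotonicity
import Literature.Geometry.Lorentzian.KerrSurfaceGravity
import Literature.Geometry.Lorentzian.EventHorizonAreaLaw
import Literature.Geometry.Lorentzian.RadiatedEnergy

/-!
# The conservation laws in bookkeeping form (line `area-excess-ratchet`, rev-2 stubs S5 β′ and law α′)

The registered stub `stub_areaRatchet` asks, for basin data `D` near `Kerr(M, a)` and a far-complete
maximal development `𝒟` with a late region `Cᵏ⁰`-converging to `g_{M′,a′}`, for
`M r₊(M,a) − C M² χ^{-q} √dist ≤ M′ r₊(M′,a′)`. Its typed hypotheses hand over no event horizon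
(`ConvergesToKerr 𝒟oc M′ a′ k₀` with `𝒟oc` free is a bare late chart of the open Kerr exterior,
cf. `exists_convergesToKerr_iff_lateChart` in §4), so the three classical steps of the
ratchet must be supplied as hypotheses over the tree's horizon vocabulary
(`EventHorizonArea`, `horizonArea`; `EventHorizonArea.lean`, `EventHorizonAreaLaw.lean`):

* (mono)  `Monotone A.horizonArea` — Hawking's area theorem; in the tree the OUTPUT of
  `VacuumCauchyDevelopment.monotone_horizonArea_of_achronalBoundary` from the named facts
  `ChruscielEtAl2001_areaTheorem`, `HawkingEllis1973_achronalBoundary` and complete generators;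
* (collar) some section dominates the collar budget, `8π(M r₊ − C M² χ^{-q} √dist) ≤ A.horizonArea v₀`
  — trapped collar (`AreaRatchetKerrCollar.lean`) swallowed by the black hole + outer-minimising
  enclosure on `Σ₀` (Penrose 1973 / Hawking–Ellis Prop. 9.2.1, 9.2.7; not in the tree);
* (final) the section areas are eventually below `8π M′ r₊(M′,a′) + ε` for every `ε > 0` — the
  identification of the late horizon with the Kerr horizon of the limit (not in the tree).

Given these, the ratchet is order arithmetic in `ℝ≥0∞` (`ratchet_of_monotone`), whence the
corrected stub `stub_areaRatchet_areaLawForm` and its conditional-on-named-facts form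
`stub_areaRatchetLaw`; and `stub_areaRatchet_of` shows that the REGISTERED signature
follows from per-development horizon-area packages (what the engine E and the classical facts must
jointly deliver). §4 records law α′ (no mass gain) in the same bookkeeping form — Bondi mass
loss and `M_B ≤ E_ADM` are the fields of the hypothesis structure `BondiFoliation.IsCanonical`
(RadiatedEnergy.lean), the ADM pinning `E_ADM(D) = M` and the Bondi foliation are handed over — and
the interface lemma `exists_convergesToKerr_iff_lateChart` (why the rev-1 hand-over was a bare chart).
Everything here is proved (wave-1 workers a55c…, a107… of lead c1).
-/

noncomputable section

-- justification: single-conjunct summit namespace `FinalStateConjecture.FinalStateConjecture` (house pattern).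
set_option linter.dupNamespace false

namespace Summit.FinalStateConjecture.FinalStateConjecture.Theorems.NearExtremalKappaCapture.AreaExcessRatchet

open Literature.Geometry.Lorentzian
open Summit.FinalStateConjecture.FinalStateConjecture.Theorems.NearExtremalKappaCapture.Negative
open scoped Manifold ContDiff Topology ENNReal
open Set Filter

/-! ## §1 The ratchet is order arithmetic once the three laws are granted -/

/-- **The ratchet from the three laws (order arithmetic).** If an `ℝ≥0∞`-valued area function
`Ar` is monotone, some value dominates `8π X`, and its values are frequently (at arbitrarily late
times) below `8π Y + ε` for every `ε > 0` with `0 ≤ Y`, then `X ≤ Y`. [folklore] -/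
theorem ratchet_of_monotone {Ar : ℝ → ℝ≥0∞} {X Y : ℝ} (hmono : Monotone Ar)
    (hlow : ∃ v₀, ENNReal.ofReal (8 * Real.pi * X) ≤ Ar v₀)
    (hfin : ∀ ε : ℝ, 0 < ε → ∃ᶠ v in atTop, Ar v ≤ ENNReal.ofReal (8 * Real.pi * Y + ε))
    (hY : 0 ≤ Y) : X ≤ Y := by
  obtain ⟨v₀, hv₀⟩ := hlow
  have hpi : 0 < 8 * Real.pi := by positivity
  refine le_of_forall_pos_lt_add fun ε hε ↦ ?_
  have hε' : 0 < 8 * Real.pi * (ε / 2) := by positivity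
  obtain ⟨v, hv, hvv₀⟩ := ((hfin (8 * Real.pi * (ε / 2)) hε').and_eventually
    (eventually_ge_atTop v₀)).exists
  have key : ENNReal.ofReal (8 * Real.pi * X) ≤
      ENNReal.ofReal (8 * Real.pi * Y + 8 * Real.pi * (ε / 2)) :=
    hv₀.trans ((hmono hvv₀).trans hv)
  have hnn : 0 ≤ 8 * Real.pi * Y + 8 * Real.pi * (ε / 2) := by positivity
  have hreal := (ENNReal.ofReal_le_ofReal_iff hnn).1 key
  have : X ≤ Y + ε / 2 := le_of_mul_le_mul_left (by linarith) hpi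
  linarith

/-! ## §2 The corrected stub β′ (area-law form) -/

/-- **Stub β′ — the area ratchet in area-law form (PROVED).** Let `D` be data on the
Kerr–Schild slice of `Kerr(M, a)`, `𝒟` a vacuum Cauchy development of `D`, `U ⊆ 𝒟` a far region
and `A` an advanced-time foliation of the event horizon `∂I⁻(U) ∩ J⁺(ιΣ)` (`EventHorizonArea`).
If (mono) the section areas are monotone (Hawking's area theorem), (collar) some section has
area at least the collar budget `8π(M r₊(M,a) − C M² (1 − (a/M)²)^{-q} √dist)` (trapped collar +
enclosure), and (final) for every `ε > 0` the section areas are frequently below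
`8π M′ r₊(M′,a′) + ε` (final-area identification), with `0 ≤ M′ r₊(M′,a′)`, then
`M r₊(M,a) − C M² (1 − (a/M)²)^{-q} √dist ≤ M′ r₊(M′,a′)`. [folklore] -/
theorem stub_areaRatchet_areaLawForm [Kerr.Facts] [Kerr.SliceFacts] {s q : ℕ}
    {δ C a M M' a' : ℝ} (hM : 0 < M) {D : InitialDataSet 𝓘(ℝ, E3) (Kerr.slice a M)}
    {𝒟 : VacuumCauchyDevelopment D} {U : Set 𝒟.carrier}
    (A : EventHorizonArea 𝒟.toCauchyDevelopment U) (hmono : Monotone A.horizonArea)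
    (hcollar : ∃ v₀, ENNReal.ofReal (8 * Real.pi * (M * Kerr.rPlus M a -
        C * M ^ 2 * (1 - (a / M) ^ 2) ^ (-(q : ℝ)) *
          √(InitialDataSet.dataWeightedSobolevEDist s δ D (Kerr.data M a M hM.le)).toReal)) ≤
      A.horizonArea v₀)
    (hfinal : ∀ ε : ℝ, 0 < ε → ∃ᶠ v in atTop,
      A.horizonArea v ≤ ENNReal.ofReal (8 * Real.pi * (M' * Kerr.rPlus M' a') + ε))
    (hM' : 0 ≤ M' * Kerr.rPlus M' a') :
    M * Kerr.rPlus M a - C * M ^ 2 * (1 - (a / M) ^ 2) ^ (-(q : ℝ)) *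
        √(InitialDataSet.dataWeightedSobolevEDist s δ D (Kerr.data M a M hM.le)).toReal ≤
      M' * Kerr.rPlus M' a' :=
  ratchet_of_monotone hmono hcollar hfinal hM'

/-- `0 ≤ M′ r₊(M′, a′)` for `0 < M′` (the closed Kerr family of the engine stub). [folklore] -/
theorem mul_rPlus_nonneg {M' : ℝ} (hM' : 0 < M') (a' : ℝ) : 0 ≤ M' * Kerr.rPlus M' a' :=
  mul_nonneg hM'.le (Kerr.rPlus_pos hM' a').le

/-- **Stub β′ with the area theorem discharged against the named facts.** For the INTRINSIC event
horizon `𝓗⁺ = ∂(visible region)` of a vacuum Cauchy development (`U = 𝒟.completeNullRayRegion`,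
`EventHorizon.lean`), monotonicity of the section areas is
`VacuumCauchyDevelopment.monotone_horizonArea_of_achronalBoundary` from the named facts
`ChruscielEtAl2001_areaTheorem` (CDGH, AHP 2 (2001), Thm. 1.1 (b)) and
`HawkingEllis1973_achronalBoundary` (Prop. 6.3.1), given future-complete generators (`hgen`, future
asymptotic predictability); the collar and final-area laws stay hypotheses. [cite: ChruscielEtAl2001, Thm. 1.1 (b)] -/
theorem stub_areaRatchetLaw [Kerr.Facts] [Kerr.SliceFacts]
    (hAT : ChruscielEtAl2001_areaTheorem.{0}) (h631 : HawkingEllis1973_achronalBoundary.{0})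
    {s q : ℕ} {δ C a M M' a' : ℝ} (hM : 0 < M) {D : InitialDataSet 𝓘(ℝ, E3) (Kerr.slice a M)}
    (𝒟 : VacuumCauchyDevelopment D) [𝒟.metric.HasLeviCivita]
    (A : EventHorizonArea 𝒟.toCauchyDevelopment 𝒟.completeNullRayRegion)
    (hgen : 𝒟.toSpacetime.IsRuledByCompleteNullGeodesics 𝒟.futureEventHorizon)
    (hcollar : ∃ v₀, ENNReal.ofReal (8 * Real.pi * (M * Kerr.rPlus M a -
        C * M ^ 2 * (1 - (a / M) ^ 2) ^ (-(q : ℝ)) *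
          √(InitialDataSet.dataWeightedSobolevEDist s δ D (Kerr.data M a M hM.le)).toReal)) ≤
      A.horizonArea v₀)
    (hfinal : ∀ ε : ℝ, 0 < ε → ∃ᶠ v in atTop,
      A.horizonArea v ≤ ENNReal.ofReal (8 * Real.pi * (M' * Kerr.rPlus M' a') + ε))
    (hM' : 0 < M') :
    M * Kerr.rPlus M a - C * M ^ 2 * (1 - (a / M) ^ 2) ^ (-(q : ℝ)) *
        √(InitialDataSet.dataWeightedSobolevEDist s δ D (Kerr.data M a M hM.le)).toReal ≤
      M' * Kerr.rPlus M' a' := by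
  exact stub_areaRatchet_areaLawForm hM A
    (𝒟.monotone_horizonArea_of_achronalBoundary hAT h631 A hgen) hcollar hfinal
    (mul_rPlus_nonneg hM' a')

/-! ## §3 What the registered signature needs per development -/

/-- **The registered `stub_areaRatchet` follows from per-development horizon-area packages.**
The package of one development `𝒟` of a datum `D` (what the engine E, the area theorem, the
enclosure law and the final-area identification must jointly deliver) is: a far region `U` and an
advanced-time foliation `A` of `∂I⁻(U) ∩ J⁺(ιΣ)` whose section areas are (i) monotone, (ii) one of
them dominates the collar budget with constant `C` and exponent `q`, and (iii) for EVERY late chart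
`Cᵏ⁰`-converging to a closed-family Kerr `g_{M′,a′}` anywhere in `𝒟` they are frequently below
`8π M′ r₊(M′,a′) + ε` (clause (iii) is where the free region `𝒟oc` of `ConvergesToKerr` bites: it
needs Kerr-parameter rigidity of late charts). Given uniform thresholds `k₀, N₀, q` and, for each
`M`, constants `c, C` such that every far-complete maximal development of basin data carries the
package, the registered signature follows by `stub_areaRatchet_areaLawForm`. This isolates exactly
what is NOT in the tree. [folklore] -/
theorem stub_areaRatchet_of [Kerr.Facts] [Kerr.SliceFacts]
    (h : ∃ (k₀ N₀ q : ℕ), ∀ (s : ℕ) (δ γ : ℝ), N₀ ≤ s → (N₀ : ℝ) ≤ δ → (N₀ : ℝ) ≤ γ →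
      ∀ (M : ℝ) (hM : 0 < M), ∃ c > (0 : ℝ), ∃ C : ℝ, ∀ a : ℝ, Kerr.IsSubextremal M a →
        ∀ (D : InitialDataSet 𝓘(ℝ, E3) (Kerr.slice a M)) [D.metric.HasLeviCivita],
          D.IsVacuumConstraintSolution →
            InitialDataSet.dataWeightedSobolevEDist s δ D (Kerr.data M a M hM.le) <
                ENNReal.ofReal (c * (1 - (a / M) ^ 2) ^ γ) →
              ∀ 𝒟 : VacuumCauchyDevelopment D, 𝒟.IsMaximal → FarComplete 𝒟 →
                ∃ (U : Set 𝒟.carrier) (A : EventHorizonArea 𝒟.toCauchyDevelopment U),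
                  Monotone A.horizonArea ∧
                  (∃ v₀, ENNReal.ofReal (8 * Real.pi * (M * Kerr.rPlus M a -
                      C * M ^ 2 * (1 - (a / M) ^ 2) ^ (-(q : ℝ)) *
                        √(InitialDataSet.dataWeightedSobolevEDist s δ D
                          (Kerr.data M a M hM.le)).toReal)) ≤ A.horizonArea v₀) ∧
                  ∀ (M' a' : ℝ) (𝒟oc : Set 𝒟.carrier), 0 < M' → |a'| ≤ M' →
                    𝒟.toSpacetime.ConvergesToKerr 𝒟oc M' a' k₀ →
                      ∀ ε : ℝ, 0 < ε → ∃ᶠ v in atTop,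
                        A.horizonArea v ≤
                          ENNReal.ofReal (8 * Real.pi * (M' * Kerr.rPlus M' a') + ε)) :
    ∃ (k₀ N₀ q : ℕ), ∀ (s : ℕ) (δ γ : ℝ), N₀ ≤ s → (N₀ : ℝ) ≤ δ → (N₀ : ℝ) ≤ γ →
      ∀ (M : ℝ) (hM : 0 < M), ∃ c > (0 : ℝ), ∃ C : ℝ, ∀ a : ℝ, Kerr.IsSubextremal M a →
        ∀ (D : InitialDataSet 𝓘(ℝ, E3) (Kerr.slice a M)) [D.metric.HasLeviCivita],
          D.IsVacuumConstraintSolution →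
            InitialDataSet.dataWeightedSobolevEDist s δ D (Kerr.data M a M hM.le) <
                ENNReal.ofReal (c * (1 - (a / M) ^ 2) ^ γ) →
              ∀ 𝒟 : VacuumCauchyDevelopment D, 𝒟.IsMaximal → FarComplete 𝒟 →
                ∀ (M' a' : ℝ) (𝒟oc : Set 𝒟.carrier), 0 < M' → |a'| ≤ M' →
                  𝒟.toSpacetime.ConvergesToKerr 𝒟oc M' a' k₀ →
                    M * Kerr.rPlus M a - C * M ^ 2 * (1 - (a / M) ^ 2) ^ (-(q : ℝ)) *
                        √(InitialDataSet.dataWeightedSobolevEDist s δ D (Kerr.data M a M hM.le)).toReal ≤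
                      M' * Kerr.rPlus M' a' := by
  obtain ⟨k₀, N₀, q, h⟩ := h
  refine ⟨k₀, N₀, q, fun s δ γ hs hδ hγ M hM ↦ ?_⟩
  obtain ⟨c, hc, C, hC⟩ := h s δ γ hs hδ hγ M hM
  refine ⟨c, hc, C, fun a ha D _ hD hdist 𝒟 hmax hfar M' a' 𝒟oc hM' ha' hconv ↦ ?_⟩
  obtain ⟨U, A, hmono, hcollar, hfinal⟩ := hC a ha D hD hdist 𝒟 hmax hfar
  exact stub_areaRatchet_areaLawForm hM A hmono hcollar (hfinal M' a' 𝒟oc hM' ha' hconv)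
    (mul_rPlus_nonneg hM' a')


/-! ## §4 Law α′ (no mass gain, Bondi bookkeeping) and the interface lemma of wave 1 -/

universe u

/-- **Mass from above, Bondi form (general carrier).** For a Cauchy development `𝒟` of
`3`-dimensional data `D` carrying a canonical future Bondi foliation `𝓕` for the asymptotically
flat end `e` (`IsCanonical`: Hawking masses converge along the cones, Bondi mass loss, positivity,
`M_B(u) ≤ E_ADM`), if the data have ADM energy `E` and a real number `M'` is dominated by the final
Bondi mass up to a budget `B` (`M' ≤ M_B(+∞) + B`; for the final Kerr state of a stability theorem
`M' = M_B(+∞)`, `B = 0`), then `M' ≤ E + B`. Bondi–van der Burg–Metzner 1962, §5;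
Christodoulou–Klainerman 1993, Ch. 17, Conclusion 17.0.4; Ashtekar–Magnon-Ashtekar 1979. -/
theorem massBound_of_isCanonical {X : Type u} [TopologicalSpace X] [ChartedSpace E3 X]
    [IsManifold (𝓡 3) ∞ X] [ConnectedSpace X] {D : InitialDataSet (𝓡 3) X}
    {𝒟 : CauchyDevelopment D} {𝓕 : 𝒟.FutureBondiFoliation} {e : AFEnd X}
    (h𝓕 : 𝓕.IsCanonical e D) {E M' B : ℝ} (hE : e.HasADMEnergy D E)
    (hM' : M' ≤ 𝓕.finalBondiMass + B) : M' ≤ E + B := by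
  have h₁ : 𝓕.finalBondiMass ≤ AFEnd.admEnergy e D :=
    LorentzianMetric.BondiFoliation.finalBondiMass_le_admEnergy h𝓕
  rw [hE.admEnergy_eq] at h₁
  linarith

/-- **Law α′ — no mass gain, Bondi form (the corrected statement of rev-1 stub α; PROVED; kernel-checked inline in the rev-2 skeleton as `massBoundBondi`).** On the Kerr–Schild slice
`Kerr.slice a M`: if the datum `D` has ADM energy `M` on the end `Kerr.afEnd a M` (pinned by the
basin for `δ ≥ -1/2`, Bartnik 1986 §4 — to be supplied), the development `𝒟` carries a canonical
future Bondi foliation `𝓕` for that end (Christodoulou–Klainerman 1993 Ch. 17 / Klainerman–Szeftel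
2023, conclusions at `𝓘⁺` — to be supplied by the engine), and the final-state parameter `M'` is at
most the final Bondi mass plus the line's budget `C (1 − (a/M)²)^{-q} √dist` (Klainerman–Szeftel
2023, Main Theorem: the Bondi mass tends to the final mass; budget `0` on paper), then
`M' ≤ M + C (1 − (a/M)²)^{-q} √dist` — verbatim the conclusion of the registered stub. -/
theorem massBoundBondi [Kerr.Facts] [Kerr.SliceFacts] {s q : ℕ} {δ C a M M' : ℝ}
    (hM : 0 < M) {D : InitialDataSet 𝓘(ℝ, E3) (Kerr.slice a M)}
    (hE : (Kerr.afEnd a M).HasADMEnergy D M) {𝒟 : VacuumCauchyDevelopment D}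
    {𝓕 : 𝒟.toCauchyDevelopment.FutureBondiFoliation} (h𝓕 : 𝓕.IsCanonical (Kerr.afEnd a M) D)
    (hM' : M' ≤ 𝓕.finalBondiMass + C * (1 - (a / M) ^ 2) ^ (-(q : ℝ)) *
      √(InitialDataSet.dataWeightedSobolevEDist s δ D (Kerr.data M a M hM.le)).toReal) :
    M' ≤ M + C * (1 - (a / M) ^ 2) ^ (-(q : ℝ)) *
      √(InitialDataSet.dataWeightedSobolevEDist s δ D (Kerr.data M a M hM.le)).toReal :=
  massBound_of_isCanonical h𝓕 hE hM'

/-- **The registered stub is a chart statement** (why `M'` is not tied to `𝓘⁺` by its hypothesis):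
for a fixed spacetime, "some region converges in `Cᵏ` to `g_{M',a'}`" is equivalent to the bare
existence of a smooth map of `Kerr.exterior M' a'`, an open embedding of the late region, with `Cᵏ`
slab deviation tending to `0` — the covering clause of `IsLateEmbedding` is discharged by
`𝒟oc := Ψ '' lateRegion τ₀`. Hence the stub's `∀ (M' a' 𝒟oc), ConvergesToKerr 𝒟oc M' a' k₀ → …` is
`∀` over such charts (anywhere in the MGHD, either time orientation). DHRT arXiv:2104.08222 §1
(consequence form). -/
theorem exists_convergesToKerr_iff_lateChart (𝓢 : Spacetime.{u} 4) (M a : ℝ) (k : ℕ) :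
    (∃ 𝒟oc : Set 𝓢.carrier, 𝓢.ConvergesToKerr 𝒟oc M a k) ↔
      ∃ (τ₀ : ℝ) (Ψ : Kerr.exterior M a → 𝓢.carrier), ContMDiff 𝓘(ℝ, E4) (𝓡 4) ∞ Ψ ∧
        Topology.IsOpenEmbedding ((Kerr.lateRegion M a τ₀).restrict Ψ) ∧
        Tendsto (fun τ ↦ 𝓢.deviationCk (Kerr.background M a) Ψ k τ) atTop (𝓝 0) := by
  constructor
  · rintro ⟨𝒟oc, τ₀, Ψ, hΨ, ht⟩
    exact ⟨τ₀, Ψ, hΨ.contMDiff, hΨ.isOpenEmbedding, ht⟩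
  · rintro ⟨τ₀, Ψ, hc, ho, ht⟩
    refine ⟨Ψ '' Kerr.lateRegion M a τ₀, τ₀, Ψ, ⟨⟨hc, ho, subset_rfl⟩, ?_⟩, ht⟩
    exact fun x hx ↦ (hx.2 hx.1).elim

end Summit.FinalStateConjecture.FinalStateConjecture.Theorems.NearExtremalKappaCapture.AreaExcessRatchet
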